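import Summits.ResolutionOfSingularities.ResolutionOfSingularities.Theorems.WeightedInvariantSuccessorRatioBoundContact
import Summits.ResolutionOfSingularities.ResolutionOfSingularities.Theorems.WeightedInvariantContactFiltrationCanonical
import Summits.ResolutionOfSingularities.ResolutionOfSingularities.Theorems.WeightedInvariantContactFiltrationUnboundedLevel
import HarnessLib

/-!
# C2 AT RATIONAL SLOPE: two parameters carrying `f` to the same rational contact weight `a/b > 1` are congruent modulo
# `𝔪^⌈a/b⌉`, and define the same rational one-flag filtration (door `HypersurfaceCentreConstruction`,
# stmt-ResolutionOfSingularities-19897; P3 rung; DEAL (o53-desc)/(o53-desc′) of res-L1-w43-plan-1 2026-08-27T19:25:19Z, PART 1 =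
# the ONE-MEMBER (degenerate two-flag, `r₂ = q`) half of σ-maximiser descent; hand res-L1-w43-stub-3)

Topic: `Summits/ResolutionOfSingularities/ResolutionOfSingularities/Theorems`. Helper for the door item
`HypersurfaceCentreConstruction` (stmt-ResolutionOfSingularities-19897, route `WeightedInvariant`), line `local-engine` (L W4.3),
def-free.  res-type-078's C2 (`ContactFiltration.mem_span_sup_pow_of_mem_contactFiltration` / `contactFiltration_eq_of_mem`, p511384)
is the canonicity of the INTEGER-level contact filtration; the σ-letters of the P3 rung read RATIONAL weights `a/b` through
res-L1-w43-idea-2's `Iota3.RatContact.ratContactFiltration g a b n = ⨆_α (g^α) 𝔪^⌈(n − aα)/b⌉` (port p560066,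
`…SuccessorRatioBoundContact`; `= flagContactFiltration g g₂ b a b n`, the one-member two-flag).  THIS FILE is C2 at rational slope:

* §1 `succ_mul_le_ceil` (arithmetic: `bt < a`, `m ≥ 1` ⇒ `tm + 1 ≤ ⌈am/b⌉`).
* §2 **`mem_span_sup_pow_of_mem_ratContactFiltration`** — `S` regular local, `0 < b < a`, `1 ≤ ν`, `f ∉ 𝔪^{ν+1}`, `g₁ ∈ 𝔪`,
  `g₂ ∈ 𝔪 ∖ 𝔪²`, `f ∈ ratContactFiltration gᵢ a b (aν)` for `i = 1, 2` ⇒ `g₁ ∈ (g₂) + 𝔪^⌈a/b⌉` (the valuation argument in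
  `S ⧸ (g₂)` verbatim, ceilings in place of products); `exists_unit_sub_mul_mem_pow_of_mem_ratContactFiltration` (unit form).
* §3 `ratContactFiltration_le_of_mem_span_sup_pow` (dominance from `g₁ ∈ (g₂) + 𝔪^⌈a/b⌉`, via res-type-070's two-flag dominance
  `flagContactFiltration_le_of_mem`), **`ratContactFiltration_eq_of_mem`** (C2 at rational slope: equal filtrations in every degree).

Consumers: σ-maximiser descent along essentially smooth maps (degenerate maximisers `r₂ = q`), res-D-brk-1's (o70-b) first-member
dominance, res-D-pv-038's (EX-4) pinning.

[OURS · L1 W4.3 · (o53-desc′) PART 1]  Replaces the role of NO printed item; NOT a statement of the manuscript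
[claim: Hironaka2017, status: under-review]. AI work, weaker than expert review.  Pure commutative algebra; no named facts.

## References

* H. Hironaka, *Characteristic polyhedra of singularities*, J. Math. Kyoto Univ. 7 (1967), Thm. (well-preparedness). [Hironaka1967]
* V. Cossart, O. Piltant, *Resolution of singularities of arithmetical threefolds II*, J. Algebra (2019), §2. [CossartPiltant2019]
-/

noncomputable section

open IsLocalRing Literature.AlgebraicGeometry.Resolution
open Summit.ResolutionOfSingularities.ResolutionOfSingularities.Cruxes.HypersurfaceCentreConstruction.LocalEngine
open Summit.ResolutionOfSingularities.ResolutionOfSingularities.Cruxes.HypersurfaceCentreConstruction.LocalEngine.Iota3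
open Summit.ResolutionOfSingularities.ResolutionOfSingularities.Cruxes.HypersurfaceCentreConstruction.LocalEngine.Iota3.RatContact

set_option linter.dupNamespace false -- mandated namespace of this single-conjunct summit

namespace Summit.ResolutionOfSingularities.ResolutionOfSingularities.Theorems

namespace RatContactCanonical

universe u

variable {S : Type u} [CommRing S]

/-! ## §1 Arithmetic of the ceilings -/

/-- `bt < a`, `1 ≤ m` ⇒ `tm + 1 ≤ ⌈am/b⌉ = (am + b - 1)/b`. [folklore] -/
theorem succ_mul_le_ceil {a b t m : ℕ} (hb : 0 < b) (hbt : b * t < a) (hm : 1 ≤ m) :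
    t * m + 1 ≤ (a * m + b - 1) / b := by
  rw [Nat.le_div_iff_mul_le hb]
  have h1 : (b * t + 1) * m ≤ a * m := Nat.mul_le_mul_right m hbt
  have h2 : (t * m + 1) * b = b * t * m + b := by ring
  have h3 : (b * t + 1) * m = b * t * m + m := by ring
  omega

/-- `t < ⌈a/b⌉` ⇒ `bt < a`. [folklore] -/
theorem mul_lt_of_lt_ceil {a b t : ℕ} (hb : 0 < b) (ht : t < (a + b - 1) / b) : b * t < a := by
  have h := Nat.lt_div_mul_add (a := a + b - 1) hb
  have h1 : t + 1 ≤ (a + b - 1) / b := ht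
  have h2 : (t + 1) * b ≤ (a + b - 1) / b * b := Nat.mul_le_mul_right b h1
  have h3 : (a + b - 1) / b * b ≤ a + b - 1 := Nat.div_mul_le_self _ _
  have h4 : (t + 1) * b = b * t + b := by ring
  omega

/-! ## §2 The key step: congruence of two parameters of the same rational contact weight -/

section KeyStep

variable [IsRegularLocalRing S]

/-- **Key step of C2 at rational slope `a/b > 1`**: `S` regular local, `0 < b < a`, `1 ≤ ν`, `f ∉ 𝔪^{ν+1}`, `g₁ ∈ 𝔪`,
`g₂ ∈ 𝔪 ∖ 𝔪²`, and `f` lies in degree `aν` of the rational contact filtrations of BOTH `g₁` and `g₂`.  Then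
`g₁ ∈ (g₂) + 𝔪^⌈a/b⌉`.  Proof: in the regular local ring `D = S ⧸ (g₂)`, `f̄ ∈ 𝔪_D^⌈aν/b⌉`; `f = c g₁^ν + f'` with `c` a unit
and `f'` in the lower pieces; if `t = ord_D(ḡ₁) < a/b` then `f̄'` has order `≥ tν + 1` and so has `f̄` (`⌈aν/b⌉ ≥ tν + 1`), while
`c̄ ḡ₁^ν` has order exactly `tν` — impossible. [cite: Hironaka1967, Thm. (well-preparedness)] -/
theorem mem_span_sup_pow_of_mem_ratContactFiltration {g₁ g₂ : S} (hg₁ : g₁ ∈ maximalIdeal S)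
    (hg₂ : g₂ ∈ maximalIdeal S) (hg₂' : g₂ ∉ maximalIdeal S ^ 2) {a b : ℕ} (hb : 0 < b) (hab : b < a) {f : S} {ν : ℕ}
    (hν : 1 ≤ ν) (hford : f ∉ maximalIdeal S ^ (ν + 1))
    (h₁ : f ∈ ratContactFiltration g₁ a b (a * ν)) (h₂ : f ∈ ratContactFiltration g₂ a b (a * ν)) :
    g₁ ∈ Ideal.span {g₂} ⊔ maximalIdeal S ^ ((a + b - 1) / b) := by
  classical
  -- the quotient `D = S/(g₂)`, a regular local ring
  haveI hD : IsRegularLocalRing (S ⧸ Ideal.span {g₂}) := (IsRegularLocalRing.quotient_span_singleton hg₂ hg₂').1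
  set mk : S →+* S ⧸ Ideal.span {g₂} := Ideal.Quotient.mk (Ideal.span {g₂}) with hmk
  have hmkmax : (maximalIdeal S).map mk = maximalIdeal (S ⧸ Ideal.span {g₂}) :=
    IsLocalRing.map_maximalIdeal_of_surjective mk Ideal.Quotient.mk_surjective
  have hcomap : ∀ k : ℕ, (maximalIdeal (S ⧸ Ideal.span {g₂}) ^ k).comap mk = Ideal.span {g₂} ⊔ maximalIdeal S ^ k :=
    fun k => by
      rw [← hmkmax, ← Ideal.map_pow, Ideal.comap_map_of_surjective mk Ideal.Quotient.mk_surjective,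
        ← RingHom.ker_eq_comap_bot, hmk, Ideal.mk_ker, sup_comm]
  -- if `g₁ ∈ (g₂)` we are done
  by_cases hzero : mk g₁ = 0
  · rw [Ideal.Quotient.eq_zero_iff_mem] at hzero
    exact Ideal.mem_sup_left hzero
  -- the order `t` of `ḡ₁`
  obtain ⟨t, ht⟩ := ENat.ne_top_iff_exists.mp (adicOrder_ne_top hzero)
  have htmem : mk g₁ ∈ maximalIdeal (S ⧸ Ideal.span {g₂}) ^ t := (le_adicOrder_iff _ _).mp ht.le
  have htnot : mk g₁ ∉ maximalIdeal (S ⧸ Ideal.span {g₂}) ^ (t + 1) := (adicOrder_le_iff _ _).mp ht.ge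
  by_cases htb : (a + b - 1) / b ≤ t
  · rw [← hcomap ((a + b - 1) / b), Ideal.mem_comap]
    exact Ideal.pow_le_pow_right htb htmem
  exfalso
  have hbt : b * t < a := mul_lt_of_lt_ceil hb (Nat.lt_of_not_le htb)
  -- `f = c g₁^ν + f'`, `f'` in the lower pieces `I'`
  set I' : Ideal S := (⨆ j, ⨆ (_ : j < ν), Ideal.span {g₁ ^ j} * maximalIdeal S ^ ((a * ν - a * j + b - 1) / b)) ⊔
    Ideal.span {g₁ ^ ν} * maximalIdeal S with hI'
  have hsplit : ratContactFiltration g₁ a b (a * ν) ≤ Ideal.span {g₁ ^ ν} ⊔ I' := by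
    rw [ratContactFiltration_def]
    refine iSup_le fun j => ?_
    by_cases hj : j < ν
    · refine le_trans ?_ le_sup_right
      rw [hI']
      refine le_trans ?_ le_sup_left
      exact le_trans (le_iSup (fun _ : j < ν => Ideal.span {g₁ ^ j} * maximalIdeal S ^ ((a * ν - a * j + b - 1) / b)) hj)
        (le_iSup (fun j => ⨆ (_ : j < ν), Ideal.span {g₁ ^ j} * maximalIdeal S ^ ((a * ν - a * j + b - 1) / b)) j)
    · push Not at hj
      refine le_trans Ideal.mul_le_right (le_trans ?_ le_sup_left)
      rw [Ideal.span_singleton_le_iff_mem, Ideal.mem_span_singleton]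
      exact pow_dvd_pow g₁ hj
  have hI'le : I' ≤ maximalIdeal S ^ (ν + 1) := by
    rw [hI']
    refine sup_le (iSup_le fun j => iSup_le fun hj => ?_) ?_
    · have h1 : Ideal.span {g₁ ^ j} ≤ maximalIdeal S ^ j := by
        rw [Ideal.span_singleton_le_iff_mem]; exact Ideal.pow_mem_pow hg₁ j
      refine le_trans (Ideal.mul_mono_left h1) ?_
      rw [← pow_add]
      exact Ideal.pow_le_pow_right (succ_le_add_ceil hb hab hj)
    · have h1 : Ideal.span {g₁ ^ ν} ≤ maximalIdeal S ^ ν := by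
        rw [Ideal.span_singleton_le_iff_mem]; exact Ideal.pow_mem_pow hg₁ ν
      refine le_trans (Ideal.mul_mono_left h1) ?_
      rw [pow_succ]
  obtain ⟨cg, hcg', f', hf', haf⟩ := Submodule.mem_sup.mp (hsplit h₁)
  obtain ⟨c, rfl⟩ := Ideal.mem_span_singleton'.mp hcg'
  -- `c` is a unit
  have hc : IsUnit c := by
    by_contra hcu
    have hcm : c ∈ maximalIdeal S := (IsLocalRing.mem_maximalIdeal _).mpr hcu
    apply hford
    rw [← haf]
    refine Ideal.add_mem _ ?_ (hI'le hf')
    have : c * g₁ ^ ν ∈ Ideal.span {g₁ ^ ν} * maximalIdeal S :=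
      Submodule.mul_mem_mul_rev (Ideal.mem_span_singleton_self _) hcm
    exact hI'le (by rw [hI']; exact Ideal.mem_sup_right this)
  -- in `D`: `f̄ ∈ 𝔪_D^⌈aν/b⌉ ⊆ 𝔪_D^{tν+1}` and `f̄' ∈ 𝔪_D^{tν+1}`, hence `c̄ ḡ₁^ν ∈ 𝔪_D^{tν+1}` — contradiction
  have htν : t * ν + 1 ≤ (a * ν + b - 1) / b := succ_mul_le_ceil hb hbt hν
  have hfD : mk f ∈ maximalIdeal (S ⧸ Ideal.span {g₂}) ^ (t * ν + 1) := by
    refine Ideal.pow_le_pow_right htν ?_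
    rw [← Ideal.mem_comap, hcomap]
    -- degree `aν` of the filtration of `g₂` lies in `(g₂) + 𝔪^⌈aν/b⌉`
    have hle : ratContactFiltration g₂ a b (a * ν) ≤ Ideal.span {g₂} ⊔ maximalIdeal S ^ ((a * ν + b - 1) / b) := by
      rw [ratContactFiltration_def]
      refine iSup_le fun j => ?_
      rcases Nat.eq_zero_or_pos j with rfl | hj
      · rw [pow_zero, Ideal.span_singleton_one, Ideal.top_mul, mul_zero, Nat.sub_zero]
        exact le_sup_right
      · refine le_trans Ideal.mul_le_right (le_trans ?_ le_sup_left)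
        rw [Ideal.span_singleton_le_iff_mem, Ideal.mem_span_singleton]
        exact dvd_pow_self g₂ hj.ne'
    exact hle h₂
  have hI'D : I'.map mk ≤ maximalIdeal (S ⧸ Ideal.span {g₂}) ^ (t * ν + 1) := by
    rw [hI', Ideal.map_sup, Ideal.map_iSup]
    refine sup_le (iSup_le fun j => ?_) ?_
    · rw [Ideal.map_iSup]
      refine iSup_le fun hj => ?_
      rw [Ideal.map_mul, Ideal.map_pow, hmkmax, Ideal.map_span, Set.image_singleton, map_pow]
      have h1 : Ideal.span {mk g₁ ^ j} ≤ maximalIdeal (S ⧸ Ideal.span {g₂}) ^ (t * j) := by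
        rw [Ideal.span_singleton_le_iff_mem, pow_mul]
        exact Ideal.pow_mem_pow htmem j
      refine le_trans (Ideal.mul_mono_left h1) ?_
      rw [← pow_add]
      refine Ideal.pow_le_pow_right ?_
      -- `t j + ⌈a(ν - j)/b⌉ ≥ t j + t(ν - j) + 1 = t ν + 1`
      have e1 : a * ν - a * j = a * (ν - j) := (mul_tsub a ν j).symm
      have h3 : t * (ν - j) + 1 ≤ (a * (ν - j) + b - 1) / b := succ_mul_le_ceil hb hbt (by omega)
      have h4 : t * j + t * (ν - j) = t * ν := by rw [← Nat.mul_add, Nat.add_sub_cancel' hj.le]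
      rw [e1]
      omega
    · rw [Ideal.map_mul, hmkmax, Ideal.map_span, Set.image_singleton, map_pow, pow_succ]
      refine Ideal.mul_mono_left ?_
      rw [Ideal.span_singleton_le_iff_mem, pow_mul]
      exact Ideal.pow_mem_pow htmem ν
  have hcg : mk (c * g₁ ^ ν) ∈ maximalIdeal (S ⧸ Ideal.span {g₂}) ^ (t * ν + 1) := by
    have : mk (c * g₁ ^ ν) = mk f - mk f' := by rw [← haf, map_add, add_sub_cancel_right]
    rw [this]
    exact Ideal.sub_mem _ hfD (hI'D (Ideal.mem_map_of_mem mk hf'))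
  have hgν : mk g₁ ^ ν ∈ maximalIdeal (S ⧸ Ideal.span {g₂}) ^ (ν * t + 1) := by
    rw [map_mul, map_pow] at hcg
    obtain ⟨u, hu⟩ := hc.map mk
    have := Ideal.mul_mem_left _ (↑u⁻¹ : S ⧸ Ideal.span {g₂}) hcg
    rw [← mul_assoc, ← hu, Units.inv_mul, one_mul, Nat.mul_comm t ν] at this
    exact this
  exact ContactFiltration.pow_not_mem_pow_of_not_mem_pow htnot ν hgν

/-- **Unit form**: under the same hypotheses, `g₁ - u g₂ ∈ 𝔪^⌈a/b⌉` for some unit `u` (res-type-078's unit step; needs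
`g₁ ∉ 𝔪²` and `⌈a/b⌉ ≥ 2`, i.e. `a > b`). [folklore] -/
theorem exists_unit_sub_mul_mem_pow_of_mem_ratContactFiltration {g₁ g₂ : S} (hg₁ : g₁ ∈ maximalIdeal S)
    (hg₁' : g₁ ∉ maximalIdeal S ^ 2) (hg₂ : g₂ ∈ maximalIdeal S) (hg₂' : g₂ ∉ maximalIdeal S ^ 2) {a b : ℕ} (hb : 0 < b)
    (hab : b < a) {f : S} {ν : ℕ} (hν : 1 ≤ ν) (hford : f ∉ maximalIdeal S ^ (ν + 1))
    (h₁ : f ∈ ratContactFiltration g₁ a b (a * ν)) (h₂ : f ∈ ratContactFiltration g₂ a b (a * ν)) :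
    ∃ u : Sˣ, g₁ - u * g₂ ∈ maximalIdeal S ^ ((a + b - 1) / b) := by
  have hc2 : 2 ≤ (a + b - 1) / b := by
    rw [Nat.le_div_iff_mul_le hb]
    omega
  exact ContactFiltration.exists_unit_sub_mul_mem_pow hg₁' hg₂ hc2
    (mem_span_sup_pow_of_mem_ratContactFiltration hg₁ hg₂ hg₂' hb hab hν hford h₁ h₂)

end KeyStep

/-! ## §3 Dominance and equality of the rational filtrations -/

section Dominance

variable [IsLocalRing S]

/-- `𝔪^⌈a/b⌉ ≤ ratContactFiltration g a b a` (the piece `α = 0` of degree `a`). [folklore] -/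
theorem pow_ceil_le_ratContactFiltration (g : S) (a b : ℕ) :
    maximalIdeal S ^ ((a + b - 1) / b) ≤ ratContactFiltration g a b a := by
  rw [ratContactFiltration_def]
  refine le_trans ?_ (le_iSup _ 0)
  rw [pow_zero, Ideal.span_singleton_one, Ideal.top_mul, mul_zero, Nat.sub_zero]

/-- `g ∈ ratContactFiltration g a b a` (the piece `α = 1`). [folklore] -/
theorem self_mem_ratContactFiltration (g : S) (a b : ℕ) : g ∈ ratContactFiltration g a b a := by
  rw [ratContactFiltration_def]
  have hle : Ideal.span {g ^ 1} * maximalIdeal S ^ ((a - a * 1 + b - 1) / b) ≤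
      ⨆ α, Ideal.span {g ^ α} * maximalIdeal S ^ ((a - a * α + b - 1) / b) :=
    le_iSup (fun α => Ideal.span {g ^ α} * maximalIdeal S ^ ((a - a * α + b - 1) / b)) 1
  refine hle ?_
  have h0 : (a - a * 1 + b - 1) / b = 0 := by
    rw [mul_one, Nat.sub_self, Nat.zero_add]
    rcases Nat.eq_zero_or_pos b with rfl | hb
    · simp
    · exact Nat.div_eq_of_lt (Nat.sub_lt hb Nat.one_pos)
  rw [h0, pow_zero, Ideal.one_eq_top, Ideal.mul_top, pow_one]
  exact Ideal.mem_span_singleton_self g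

/-- **Dominance**: `g₁ ∈ (g₂) + 𝔪^⌈a/b⌉` transfers the rational filtration of `g₁` into that of `g₂` (via res-type-070's
two-flag dominance `flagContactFiltration_le_of_mem`, the one-member two-flag `(gᵢ, 0)` with `q = r₂ = b` being the rational
filtration of `gᵢ`, `flagContactFiltration_eq_ratContactFiltration`). [folklore] -/
theorem ratContactFiltration_le_of_mem_span_sup_pow {g₁ g₂ : S} {a b : ℕ} (hb : 0 < b)
    (h : g₁ ∈ Ideal.span {g₂} ⊔ maximalIdeal S ^ ((a + b - 1) / b)) (n : ℕ) :
    ratContactFiltration g₁ a b n ≤ ratContactFiltration g₂ a b n := by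
  have h0 : (0 : S) ∈ maximalIdeal S := zero_mem _
  rw [← flagContactFiltration_eq_ratContactFiltration (g₁ := g₁) h0 hb n,
    ← flagContactFiltration_eq_ratContactFiltration (g₁ := g₂) h0 hb n]
  refine flagContactFiltration_le_of_mem hb ?_ (zero_mem _) n
  rw [flagContactFiltration_eq_ratContactFiltration h0 hb]
  have hle : Ideal.span {g₂} ⊔ maximalIdeal S ^ ((a + b - 1) / b) ≤ ratContactFiltration g₂ a b a :=
    sup_le (by rw [Ideal.span_singleton_le_iff_mem]; exact self_mem_ratContactFiltration g₂ a b)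
      (pow_ceil_le_ratContactFiltration g₂ a b)
  exact hle h

end Dominance

/-- **C2 AT RATIONAL SLOPE — CANONICITY OF THE RATIONAL ONE-FLAG FILTRATION**: in a regular local ring, two parameters
`g₁, g₂ ∈ 𝔪 ∖ 𝔪²` which both carry `f` (`f ∉ 𝔪^{ν+1}`, `ν ≥ 1`) to the rational contact weight `a/b > 1` define the SAME
rational filtration in every degree. [cite: Hironaka1967, Thm. (well-preparedness)] [cite: CossartPiltant2019, §2] -/
theorem ratContactFiltration_eq_of_mem [IsRegularLocalRing S] {g₁ g₂ : S} (hg₁ : g₁ ∈ maximalIdeal S)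
    (hg₁' : g₁ ∉ maximalIdeal S ^ 2) (hg₂ : g₂ ∈ maximalIdeal S) (hg₂' : g₂ ∉ maximalIdeal S ^ 2) {a b : ℕ} (hb : 0 < b)
    (hab : b < a) {f : S} {ν : ℕ} (hν : 1 ≤ ν) (hford : f ∉ maximalIdeal S ^ (ν + 1))
    (h₁ : f ∈ ratContactFiltration g₁ a b (a * ν)) (h₂ : f ∈ ratContactFiltration g₂ a b (a * ν)) (n : ℕ) :
    ratContactFiltration g₁ a b n = ratContactFiltration g₂ a b n :=
  le_antisymm
    (ratContactFiltration_le_of_mem_span_sup_pow hb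
      (mem_span_sup_pow_of_mem_ratContactFiltration hg₁ hg₂ hg₂' hb hab hν hford h₁ h₂) n)
    (ratContactFiltration_le_of_mem_span_sup_pow hb
      (mem_span_sup_pow_of_mem_ratContactFiltration hg₂ hg₁ hg₁' hb hab hν hford h₂ h₁) n)


end RatContactCanonical

end Summit.ResolutionOfSingularities.ResolutionOfSingularities.Theorems

end
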